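import Mathlib
import HarnessLib

/-!
# Magnen–Rivasseau–Sénéor, *Construction of YM₄ with an infrared cutoff* (CMP 155, 1993), Appendix 1, the case `t ≠ 0`: the function
# `H(β)` (A.7) and the printed residue evaluation of `dH/dβ` — (A.13)–(A.19), (A.21)–(A.25) AS PRINTED (definitions), their printed
# assembly kernel-checked ((A.16) = (A.13) + (A.14), (A.18) = (A.13) + (A.15), (A.22) = (A.19) + (A.21), (A.23)/(A.25) = κ·A(κβ) + B,
# the radicand of (A.21) = the discriminant of (A.11)'s denominator), and the misprinted pole location (A.20) exhibited

statement-level skeleton of published theorems with citation tags; proofs where landed; nothing here is a claim about the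
Yang–Mills mass gap, about continuum YM₄ on T⁴, or about the Clay problem

**Citation header (reproduction of PUBLISHED work).** J. Magnen, V. Rivasseau, R. Sénéor, *Construction of YM₄ with an infrared
cutoff*, Commun. Math. Phys. **155** (1993) 325–383 [MagnenRivasseauSeneor1993], Appendix 1 pp. 380–382 [PDF 56–58]. The displays
(A.7)–(A.25) are garbled beyond use in the text layer of the held scan `paper:magnen1993-cmp155-mrs-ym4-infrared-cutoff`; they were read
on 1/3- and 1/2-scale renders of the 600-dpi page images (`run/shared/lean/pub/pub-balaban-gaps/pub-balaban-gaps-mrs-lit-2/g3/renders/`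
`p56_crop_r300-3000_s3.png`, `p56_crop_r2900-5650_s3.png`, `p57_crop_r300-3000_s3.png`, `p57_crop_r2900-5650_s3.png`,
`p57_crop_r3850-4250_s2.png`, `p58_crop_r300-3000_s3.png`). Cell pub-balaban-gaps (YM blitz, track G3), seat mrs-lit-2 (gen 3); companion
record `run/shared/lean/pub/pub-balaban-gaps/g3/MRS-AS-PRINTED-estimates.md` §3(j). Sibling files: `MRS93AppendixWarmUp.lean` (the
`t = 0` warm-up (A.1)–(A.5), where the `θ`-integrals below are EVALUATED in closed form and proved), `MRS93LemmaVI2FeynmanGauge.lean` §8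
((A.26), the slope of `H` at `β = 0`, proved from the integrand), `MRS93AppendixFeynmanGauge.lean` ((A.6), (A.27)–(A.29)).

**What the paper prints (verbatim, from the page images; `β′ ≡ κβ`, `τ′ ≡ 7τ/4`, `w = s² = τcos²φ`).**
* (A.7) p.380: «If we put s = √τ cos φ and w = s², we have therefore to bound the integral
  `H(β) = (1/2)∫_{−√τ}^{√τ} ds/√τ ∫₀^π (4/π) sin²θ dθ ln|1 − βκ(cos²θ + w sin²θ)| − 2 ln(1 + 2β(1 + 7/8 τ − 2cos²θ − 2w sin²θ) + β²)`. (A.7)»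
* p.380 tl.: «… we decide to regularize the singularity in the logarithm by adding +iε and taking the real part … Then we derive with
  respect to β and changing to the variable z = e^{2iθ} we have a rational contour integral to compute. It is convenient to define
  β′ = κβ.» (A.9): «`d/dβ H(β) = (1/2)∫_{−√τ}^{√τ} ds/√τ [κA + B]`», (A.10): «`A = (1/2iπ)∮_{|z|=1} dz/z² (2z − z² − 1) ×
  lim_{ε→0} Re (−4wz − (1 − w)(2z + z² + 1))/((4 − 4β′w)z − β′(1 − w)(2z + z² + 1) + 4iεz)`», (A.11): «`B = (1/2iπ)∮_{|z|=1} dz/z²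
  (2z − z² − 1) × [(−2)(−2wz − (1 − w)(z² + 1) + 2βz + 7τz/4)/((1 − 2βw)z − β(1 − w)(z² + 1) + β²z + 7βτz/4)]`».
* (A.13): «The pole at z = 0 for the first piece of the integrand gives a real contribution equal to `−2(2 − β′ + β′w)/((β′)²(1 − w))`.»
  (A.14): «For β′ < 1 there is the contribution of one real pole inside the unit disk, with residue
  `4(1 − β′)/((β′)²(1 − w)√(1 − β′ − β′w + (β′)²w))`.» (A.15): «For β′ > 1/w there is another pole inside the unit circle with residue:
  `4(β′ − 1)/((β′)²(1 − w)√(1 − β′ − β′w + (β′)²w))`.» [for `1 < β′ < 1/w` the poles `z_±` of (A.12) «become purely imaginary … they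
  disappear».]
* (A.16)–(A.18): «Hence `A = 2/((β′)²(1 − w)) × [−2 + β′(1 − w) + 2(1 − β′)/√((1 − β′)(1 − β′w))]` if β′ < 1, (A.16)
  `A = 2/((β′)²(1 − w)) [−2 + β′(1 − w)]` if 1 < β′ < 1/w, (A.17) `A = 2/((β′)²(1 − w)) × [−2 + β′(1 − w) − 2(1 − β′)/√((1 − β′)(1 − β′w))]`
  if β′ > 1/w. (A.18)»
* (A.19): «The term B has a pole at z = 0 giving the contribution `2(1 − β² − 2β + 2βw)/(β²(1 − w))`.» (A.20): «Finally there is a pole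
  inside the unit disk at the location `((1 − β)² + βτ′ − √((1 − 2βw + β² + βτ′)² − 4β²(1 + w²)))/(2β(1 − w))`, where τ′ ≡ 7τ/4, which
  gives the contribution» (A.21): «`−2((1 − β)² + βτ′)(1 − β²)/(β²(1 − w)√((1 − β)²[(1 + β)² − 4βw] + βτ′(2 − 4βw + 2β² + βτ′)))`.»
  (A.22): «Therefore we have `B = 2/(β²(1 − w)) [1 − β² − 2β + 2βw − ((1 − β)² + βτ′)(1 − β²)/√((1 − β)²[(1 + β)² − 4βw] + βτ′(2 − 4βw +
  2β² + βτ′))]`.»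
* (A.23)–(A.25) p.382: «Adding κA and B we find `κA + B = 2/(β²(1 − w)) × [1 − 2/κ − β(1 − w) − β² + 2(1 − βκ)/(κ√((1 − βκ)(1 − βκw)))
  − ((1 − β)² + βτ′)(1 − β²)/√((1 − β)²[(1 + β)² − 4βw] + βτ′(2 − 4βw + 2β² + βτ′))]` if βκ < 1, (A.23) [the same without the `2(1 − βκ)/…`
  term] if 1 < βκ < 1/w, (A.24)» and, display (A.25) in full: «`κA + B = 2/(β²(1 − w)) × [1 − 2/κ − β(1 − w) − β² − 2(1 − βκ)/(κ√((1 − βκ)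
  (1 − βκw))) − ((1 − β)² + βτ′)(1 − β²)/√((1 − β)²[(1 + β)² − 4βw] + βτ′(1 − 4βw + 2β² + βτ′))]` if βκ > 1/w. (A.25)» — NOTE the radicand
  of (A.25) is PRINTED «βτ′(1 − 4βw + 2β² + βτ′)» [sic] (page image `p58`, native-resolution crop of the display), where (A.21), (A.22),
  (A.23), (A.24) all print «βτ′(2 − 4βw + 2β² + βτ′)»; the typed `kAB_A25` below uses the (A.21)–(A.24) radicand `radicand_A21` (the one
  the paper's own assembly «Adding κA and B» requires: `kAB_A25_eq`; and the discriminant of (A.11)'s denominator: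
  `A21_radicand_eq_discriminant`). This is Appendix 1's second misprint (after the pole location (A.20)); recorded in the companion record
  §3(j). (Docfix v1.1, referee R8 [REF-G9] finding F-A25; no Lean statement changed.)
* p.382 tl.: «It is possible to integrate explicitly the formula for H, but we do not give the expression here. Using the asymptotic
  expansion (A.26) near β = 0, the fact that τ varies in the compact interval [0, 1] and the fact that the derivative of H is bounded by a
  constant at large β we can of course always achieve a uniform bound as in Sect. VI.»

**What is typed / PROVED here (zero `sorry`, zero named facts; every `def` has a body).**
* §1 (A.7) `H_A7 β κ τ` and its `θ`-integrals `fpTheta β′ w`, `bosonTheta β w τ` as definitions (interval integrals; at `τ = 0`: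
  `fpTheta = AppendixOne.fpLogAvg`, `bosonTheta β 0 0 = −bosonLogAvg β` after (A.2) — recorded in the docstrings, not restated).
* §2 the printed residues and totals as definitions: `res_A13`, `res_A14`, `res_A15`, `A_A16`, `A_A17`, `A_A18`, `res_A19`, `res_A21`,
  `B_A22`, `kAB_A23`, `kAB_A24`, `kAB_A25`, and the two printed pole-location expressions `pole_A20_printed`, `pole_A20_corrected`
  (= the root of (A.11)'s denominator `den_A11`).
* §3 KERNEL (the printed ASSEMBLY, exactly as the prose says): `A14_radicand_eq` (`1 − β′ − β′w + β′²w = (1 − β′)(1 − β′w)`),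
  `A_A16_eq` ((A.16) = (A.13) + (A.14)), `A_A17_eq` ((A.17) = (A.13)), `A_A18_eq` ((A.18) = (A.13) + (A.15)), `B_A22_eq` ((A.22) = (A.19) +
  (A.21)), **`kAB_A23_eq`/`kAB_A24_eq`/`kAB_A25_eq`** («Adding κA and B»: (A.23)/(A.24)/(A.25) = `κ·A(κβ) + B` with the matching branch
  of `A`), `A21_radicand_eq_discriminant` (the radicand of (A.21)/(A.22) IS the discriminant `(1 − 2βw + β² + βτ′)² − 4β²(1 − w)²` of
  `den_A11`), `den_A11_pole_corrected` (the corrected location is a root of `den_A11` whenever the discriminant is `≥ 0`), and the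
  MISPRINT in (A.20) exhibited: `A20_printed_radicand_neg_example` (at `β = 1/2`, `w = 5/8`, `τ′ = 0` the printed radicand
  `(…)² − 4β²(1 + w²)` is `−1 < 0` although `den_A11` has the real root `1/3` inside the unit disk: `den_A11_example_root`) and
  `A20_printed_ne_root_example` (at `w = 0 = τ′`, `β = 1/2`, where both radicands equal `9/16`: the printed location is `−1/2`, not a
  root; the root is `1/2`).
* §4 (v1.1) the radicand of (A.25) exactly AS PRINTED, `radicand_A25_printed` («… + βτ′(1 − 4βw + 2β² + βτ′)» [sic]), with
  `radicand_A25_printed_eq` (= `radicand_A21 − βτ′`), `radicand_A25_printed_eq_of_tau_zero`, `radicand_A25_printed_ne` (differs from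
  the (A.21)–(A.24) radicand iff `βτ′ ≠ 0`). With (A.25) read through the (A.21)–(A.24) radicand — as `kAB_A25` does — the numerics
  below reproduce it; read literally, (A.25) would not even be the sum «κA + B» of the displays above it.

**Findings (companion record §3(j)).** NUMERICS (seat script `…/pub-balaban-gaps-mrs-lit-2/g3/a16_a25_check.py` sha16 b5145e67ec147eba, output
`a16_a25_check.out.txt` 7952e4a545cb6744; pure-Python double-exponential quadrature of the `θ`-integrals of (A.7), central differences
`h = 1e−5`): (A.16)/(A.17)/(A.18) reproduce `∂fpTheta/∂β′` on 60 points `(w, β′)` across the three ranges (worst deviation 9e−8, near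
`β′ = 0.97`; elsewhere ≤ 5e−9); (A.22) reproduces `∂bosonTheta/∂β` on 190 points `(τ, w, β)` (worst 4e−9); (A.23)/(A.24)/(A.25) reproduce
`κ ∂_{β′}fpTheta + ∂_β bosonTheta` on 96 points (worst 5e−9). So the printed residue computation is CORRECT in every branch; the two
transcription slips of the print are (1) the displayed pole LOCATION (A.20) — «(1 − β)² + βτ′» for `1 − 2βw + β² + βτ′` and «4β²(1 + w²)»
for `4β²(1 − w)²` — immaterial, since the residue (A.21) is printed with the correct discriminant (kernel: `A21_radicand_eq_discriminant`),
and (2) the «1 − 4βw» in the radicand of (A.25) for (A.21)–(A.24)'s «2 − 4βw» (§4; referee finding F-A25) — immaterial for the same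
reason (the assembly `kAB_A25_eq` fixes the radicand). NOT a kernel fact: the equality of `A`, `B` with the derivatives of the integrals
(that is the numerics); (A.9) (differentiation under the integral); (A.12).

**What is NOT claimed.** (A.8)–(A.12) as contour integrals; `dH/dβ = (1/2)∫[κA + B]`; the large-`β` boundedness of `H′`; Lemma VI.2 /
VI.1 (see `MRS93LemmaVI2FeynmanGauge.lean` for ζ = 1). Nothing here bears on Bałaban's papers; nothing is continuum YM₄ on T⁴, nothing
lifts the infrared cutoff, nothing is Clay.
-/

noncomputable section

open Real MeasureTheory Set intervalIntegral

namespace Literature.MathematicalPhysics.QuantumFieldTheory.MagnenRivasseauSeneor1993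

namespace AppendixOne

/-! ## §1 (A.7) -/

/-- The Faddeev–Popov `θ`-integral of (A.7) as a function of `β′ = κβ` and `w`: `(4/π)∫₀^π sin²θ ln|1 − β′(cos²θ + w sin²θ)| dθ`
(at `w = 0` this is `fpLogAvg β′` of `MRS93AppendixWarmUp.lean`). [cite: MagnenRivasseauSeneor1993, App. 1 (A.7) p.380] -/
def fpTheta (β' w : ℝ) : ℝ :=
  4 / π * ∫ θ in (0 : ℝ)..π, Real.sin θ ^ 2 * Real.log |1 - β' * (Real.cos θ ^ 2 + w * Real.sin θ ^ 2)|

/-- The boson `θ`-integral of (A.7) (after (A.6)): `(4/π)∫₀^π sin²θ (−2) ln(1 + 2β(1 + 7τ/8 − 2cos²θ − 2w sin²θ) + β²) dθ`.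
[cite: MagnenRivasseauSeneor1993, App. 1 (A.7) p.380] -/
def bosonTheta (β w τ : ℝ) : ℝ :=
  4 / π * ∫ θ in (0 : ℝ)..π, Real.sin θ ^ 2 *
    ((-2) * Real.log (1 + 2 * β * (1 + 7 / 8 * τ - 2 * Real.cos θ ^ 2 - 2 * w * Real.sin θ ^ 2) + β ^ 2))

/-- **(A.7)** p.380 [PDF 56], verbatim: «`H(β) = (1/2)∫_{−√τ}^{√τ} ds/√τ ∫₀^π (4/π) sin²θ dθ ln|1 − βκ(cos²θ + w sin²θ)| −
2 ln(1 + 2β(1 + 7/8 τ − 2cos²θ − 2w sin²θ) + β²)` (A.7)» with `w = s²` — typed as the `s`-integral of the two `θ`-integrals (for `τ > 0`;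
the paper's `t ≠ 0`). [cite: MagnenRivasseauSeneor1993, App. 1 (A.7) p.380] -/
def H_A7 (β κ τ : ℝ) : ℝ :=
  1 / 2 * ∫ s in (-Real.sqrt τ)..Real.sqrt τ, (fpTheta (κ * β) (s ^ 2) + bosonTheta β (s ^ 2) τ) / Real.sqrt τ

/-! ## §2 The printed residues, totals and pole locations (definitions, verbatim) -/

/-- (A.13): `−2(2 − β′ + β′w)/((β′)²(1 − w))`. [cite: MagnenRivasseauSeneor1993, App. 1 (A.13) p.380] -/
def res_A13 (β' w : ℝ) : ℝ := -2 / (β' ^ 2 * (1 - w)) * (2 - β' + β' * w)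

/-- (A.14): `4(1 − β′)/((β′)²(1 − w)√(1 − β′ − β′w + (β′)²w))` (β′ < 1). [cite: MagnenRivasseauSeneor1993, App. 1 (A.14) p.381] -/
def res_A14 (β' w : ℝ) : ℝ := 4 * (1 - β') / (β' ^ 2 * (1 - w) * Real.sqrt (1 - β' - β' * w + β' ^ 2 * w))

/-- (A.15): `4(β′ − 1)/((β′)²(1 − w)√(1 − β′ − β′w + (β′)²w))` (β′ > 1/w). [cite: MagnenRivasseauSeneor1993, App. 1 (A.15) p.381] -/
def res_A15 (β' w : ℝ) : ℝ := 4 * (β' - 1) / (β' ^ 2 * (1 - w) * Real.sqrt (1 - β' - β' * w + β' ^ 2 * w))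

/-- (A.16): `A = 2/((β′)²(1 − w)) × [−2 + β′(1 − w) + 2(1 − β′)/√((1 − β′)(1 − β′w))]` (β′ < 1).
[cite: MagnenRivasseauSeneor1993, App. 1 (A.16) p.381] -/
def A_A16 (β' w : ℝ) : ℝ :=
  2 / (β' ^ 2 * (1 - w)) * (-2 + β' * (1 - w) + 2 * (1 - β') / Real.sqrt ((1 - β') * (1 - β' * w)))

/-- (A.17): `A = 2/((β′)²(1 − w)) [−2 + β′(1 − w)]` (1 < β′ < 1/w). [cite: MagnenRivasseauSeneor1993, App. 1 (A.17) p.381] -/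
def A_A17 (β' w : ℝ) : ℝ := 2 / (β' ^ 2 * (1 - w)) * (-2 + β' * (1 - w))

/-- (A.18): `A = 2/((β′)²(1 − w)) × [−2 + β′(1 − w) − 2(1 − β′)/√((1 − β′)(1 − β′w))]` (β′ > 1/w).
[cite: MagnenRivasseauSeneor1993, App. 1 (A.18) p.381] -/
def A_A18 (β' w : ℝ) : ℝ :=
  2 / (β' ^ 2 * (1 - w)) * (-2 + β' * (1 - w) - 2 * (1 - β') / Real.sqrt ((1 - β') * (1 - β' * w)))

/-- (A.19): `2(1 − β² − 2β + 2βw)/(β²(1 − w))`. [cite: MagnenRivasseauSeneor1993, App. 1 (A.19) p.381] -/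
def res_A19 (β w : ℝ) : ℝ := 2 / (β ^ 2 * (1 - w)) * (1 - β ^ 2 - 2 * β + 2 * β * w)

/-- The radicand of (A.21)/(A.22): `(1 − β)²[(1 + β)² − 4βw] + βτ′(2 − 4βw + 2β² + βτ′)`.
[cite: MagnenRivasseauSeneor1993, App. 1 (A.21) p.381] -/
def radicand_A21 (β w τ' : ℝ) : ℝ :=
  (1 - β) ^ 2 * ((1 + β) ^ 2 - 4 * β * w) + β * τ' * (2 - 4 * β * w + 2 * β ^ 2 + β * τ')

/-- (A.21): `−2((1 − β)² + βτ′)(1 − β²)/(β²(1 − w)√(radicand))`. [cite: MagnenRivasseauSeneor1993, App. 1 (A.21) p.381] -/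
def res_A21 (β w τ' : ℝ) : ℝ :=
  -2 * (((1 - β) ^ 2 + β * τ') * (1 - β ^ 2)) / (β ^ 2 * (1 - w) * Real.sqrt (radicand_A21 β w τ'))

/-- (A.22): `B = 2/(β²(1 − w)) [1 − β² − 2β + 2βw − ((1 − β)² + βτ′)(1 − β²)/√(radicand)]`.
[cite: MagnenRivasseauSeneor1993, App. 1 (A.22) p.381] -/
def B_A22 (β w τ' : ℝ) : ℝ :=
  2 / (β ^ 2 * (1 - w)) *
    (1 - β ^ 2 - 2 * β + 2 * β * w - ((1 - β) ^ 2 + β * τ') * (1 - β ^ 2) / Real.sqrt (radicand_A21 β w τ'))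

/-- (A.23): `κA + B` for `βκ < 1`. [cite: MagnenRivasseauSeneor1993, App. 1 (A.23) p.382] -/
def kAB_A23 (β κ w τ' : ℝ) : ℝ :=
  2 / (β ^ 2 * (1 - w)) *
    (1 - 2 / κ - β * (1 - w) - β ^ 2 + 2 * (1 - β * κ) / (κ * Real.sqrt ((1 - β * κ) * (1 - β * κ * w)))
      - ((1 - β) ^ 2 + β * τ') * (1 - β ^ 2) / Real.sqrt (radicand_A21 β w τ'))

/-- (A.24): `κA + B` for `1 < βκ < 1/w`. [cite: MagnenRivasseauSeneor1993, App. 1 (A.24) p.382] -/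
def kAB_A24 (β κ w τ' : ℝ) : ℝ :=
  2 / (β ^ 2 * (1 - w)) *
    (1 - 2 / κ - β * (1 - w) - β ^ 2 - ((1 - β) ^ 2 + β * τ') * (1 - β ^ 2) / Real.sqrt (radicand_A21 β w τ'))

/-- (A.25): `κA + B` for `βκ > 1/w`. AS PRINTED the radicand of the last term reads «(1 − β)²[(1 + β)² − 4βw] + βτ′(1 − 4βw + 2β² + βτ′)»
[sic] — a «1» where (A.21)–(A.24) print «2 − 4βw + …»; this definition uses the (A.21)–(A.24) radicand `radicand_A21` (= the one the
assembly (A.25) = κ·(A.18)(κβ) + (A.22) requires, `kAB_A25_eq`; the two readings coincide at `τ′ = 0`).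
[cite: MagnenRivasseauSeneor1993, App. 1 (A.25) p.382] -/
def kAB_A25 (β κ w τ' : ℝ) : ℝ :=
  2 / (β ^ 2 * (1 - w)) *
    (1 - 2 / κ - β * (1 - w) - β ^ 2 - 2 * (1 - β * κ) / (κ * Real.sqrt ((1 - β * κ) * (1 - β * κ * w)))
      - ((1 - β) ^ 2 + β * τ') * (1 - β ^ 2) / Real.sqrt (radicand_A21 β w τ'))

/-- The denominator of (A.11) as a polynomial in `z` (`τ′ = 7τ/4`): `(1 − 2βw)z − β(1 − w)(z² + 1) + β²z + βτ′z`.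
[cite: MagnenRivasseauSeneor1993, App. 1 (A.11) p.380] -/
def den_A11 (β w τ' z : ℝ) : ℝ := (1 - 2 * β * w) * z - β * (1 - w) * (z ^ 2 + 1) + β ^ 2 * z + β * τ' * z

/-- (A.20) AS PRINTED: `((1 − β)² + βτ′ − √((1 − 2βw + β² + βτ′)² − 4β²(1 + w²)))/(2β(1 − w))`.
[cite: MagnenRivasseauSeneor1993, App. 1 (A.20) p.381] -/
def pole_A20_printed (β w τ' : ℝ) : ℝ :=
  ((1 - β) ^ 2 + β * τ' - Real.sqrt ((1 - 2 * β * w + β ^ 2 + β * τ') ^ 2 - 4 * β ^ 2 * (1 + w ^ 2))) / (2 * β * (1 - w))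

/-- (A.20) CORRECTED (ours): the root of `den_A11` inside the unit disk,
`((1 − 2βw + β² + βτ′) − √((1 − 2βw + β² + βτ′)² − 4β²(1 − w)²))/(2β(1 − w))` — its discriminant is exactly the radicand printed in (A.21).
[cite: MagnenRivasseauSeneor1993, App. 1 (A.20)–(A.21) p.381] -/
def pole_A20_corrected (β w τ' : ℝ) : ℝ :=
  ((1 - 2 * β * w + β ^ 2 + β * τ') - Real.sqrt ((1 - 2 * β * w + β ^ 2 + β * τ') ^ 2 - 4 * β ^ 2 * (1 - w) ^ 2)) / (2 * β * (1 - w))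

/-! ## §3 The printed assembly, kernel-checked -/

/-- The radicand of (A.14)/(A.15) factorises as in (A.16)/(A.18): `1 − β′ − β′w + β′²w = (1 − β′)(1 − β′w)`.
[cite: MagnenRivasseauSeneor1993, App. 1 (A.14)–(A.16) p.381] -/
theorem A14_radicand_eq (β' w : ℝ) : 1 - β' - β' * w + β' ^ 2 * w = (1 - β') * (1 - β' * w) := by ring

/-- «Hence» (A.16) = (A.13) + (A.14) (for `β′ ≠ 0`, `w ≠ 1`). [cite: MagnenRivasseauSeneor1993, App. 1 (A.16) p.381] -/
theorem A_A16_eq {β' w : ℝ} (hβ : β' ≠ 0) (hw : w ≠ 1) : A_A16 β' w = res_A13 β' w + res_A14 β' w := by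
  unfold A_A16 res_A13 res_A14
  rw [A14_radicand_eq]
  have h1 : (1 - w) ≠ 0 := sub_ne_zero.mpr (Ne.symm hw)
  field_simp
  ring

/-- (A.17) = (A.13) (no pole inside the disk besides `z = 0` for `1 < β′ < 1/w`). [cite: MagnenRivasseauSeneor1993, App. 1 (A.17) p.381] -/
theorem A_A17_eq (β' w : ℝ) : A_A17 β' w = res_A13 β' w := by
  unfold A_A17 res_A13
  ring

/-- (A.18) = (A.13) + (A.15) (for `β′ ≠ 0`, `w ≠ 1`). [cite: MagnenRivasseauSeneor1993, App. 1 (A.18) p.381] -/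
theorem A_A18_eq {β' w : ℝ} (hβ : β' ≠ 0) (hw : w ≠ 1) : A_A18 β' w = res_A13 β' w + res_A15 β' w := by
  unfold A_A18 res_A13 res_A15
  rw [A14_radicand_eq]
  have h1 : (1 - w) ≠ 0 := sub_ne_zero.mpr (Ne.symm hw)
  field_simp
  ring

/-- «Therefore we have» (A.22) = (A.19) + (A.21) (for `β ≠ 0`, `w ≠ 1`). [cite: MagnenRivasseauSeneor1993, App. 1 (A.22) p.381] -/
theorem B_A22_eq {β w : ℝ} (hβ : β ≠ 0) (hw : w ≠ 1) (τ' : ℝ) : B_A22 β w τ' = res_A19 β w + res_A21 β w τ' := by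
  unfold B_A22 res_A19 res_A21
  have h1 : (1 - w) ≠ 0 := sub_ne_zero.mpr (Ne.symm hw)
  field_simp
  ring

/-- **«Adding κA and B we find» (A.23)**: `kAB_A23 β κ w τ′ = κ·A_A16(κβ, w) + B_A22(β, w, τ′)` (for `β, κ ≠ 0`, `w ≠ 1`).
[cite: MagnenRivasseauSeneor1993, App. 1 (A.23) p.382] -/
theorem kAB_A23_eq {β κ w : ℝ} (hβ : β ≠ 0) (hκ : κ ≠ 0) (hw : w ≠ 1) (τ' : ℝ) :
    kAB_A23 β κ w τ' = κ * A_A16 (κ * β) w + B_A22 β w τ' := by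
  unfold kAB_A23 A_A16 B_A22
  have h1 : (1 - w) ≠ 0 := sub_ne_zero.mpr (Ne.symm hw)
  rw [show κ * β = β * κ by ring]
  field_simp
  ring

/-- (A.24) = `κ·A_A17(κβ, w) + B_A22` (for `β, κ ≠ 0`, `w ≠ 1`). [cite: MagnenRivasseauSeneor1993, App. 1 (A.24) p.382] -/
theorem kAB_A24_eq {β κ w : ℝ} (hβ : β ≠ 0) (hκ : κ ≠ 0) (hw : w ≠ 1) (τ' : ℝ) :
    kAB_A24 β κ w τ' = κ * A_A17 (κ * β) w + B_A22 β w τ' := by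
  unfold kAB_A24 A_A17 B_A22
  have h1 : (1 - w) ≠ 0 := sub_ne_zero.mpr (Ne.symm hw)
  field_simp
  ring

/-- (A.25) = `κ·A_A18(κβ, w) + B_A22` (for `β, κ ≠ 0`, `w ≠ 1`). [cite: MagnenRivasseauSeneor1993, App. 1 (A.25) p.382] -/
theorem kAB_A25_eq {β κ w : ℝ} (hβ : β ≠ 0) (hκ : κ ≠ 0) (hw : w ≠ 1) (τ' : ℝ) :
    kAB_A25 β κ w τ' = κ * A_A18 (κ * β) w + B_A22 β w τ' := by
  unfold kAB_A25 A_A18 B_A22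
  have h1 : (1 - w) ≠ 0 := sub_ne_zero.mpr (Ne.symm hw)
  rw [show κ * β = β * κ by ring]
  field_simp
  ring

/-- The radicand printed in (A.21)/(A.22) IS the discriminant of `den_A11` (as a quadratic in `z`):
`(1 − β)²[(1 + β)² − 4βw] + βτ′(2 − 4βw + 2β² + βτ′) = (1 − 2βw + β² + βτ′)² − 4β²(1 − w)²`.
[cite: MagnenRivasseauSeneor1993, App. 1 (A.20)–(A.21) p.381] -/
theorem A21_radicand_eq_discriminant (β w τ' : ℝ) :
    radicand_A21 β w τ' = (1 - 2 * β * w + β ^ 2 + β * τ') ^ 2 - 4 * β ^ 2 * (1 - w) ^ 2 := by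
  unfold radicand_A21
  ring

/-- The corrected pole location is a root of `den_A11` whenever the discriminant is nonnegative (`β ≠ 0`, `w ≠ 1`).
[cite: MagnenRivasseauSeneor1993, App. 1 (A.11), (A.20) pp.380–381] -/
theorem den_A11_pole_corrected {β w τ' : ℝ} (hβ : β ≠ 0) (hw : w ≠ 1)
    (hD : 0 ≤ (1 - 2 * β * w + β ^ 2 + β * τ') ^ 2 - 4 * β ^ 2 * (1 - w) ^ 2) :
    den_A11 β w τ' (pole_A20_corrected β w τ') = 0 := by
  unfold den_A11 pole_A20_corrected
  set D := (1 - 2 * β * w + β ^ 2 + β * τ') ^ 2 - 4 * β ^ 2 * (1 - w) ^ 2 with hDdef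
  have hs : Real.sqrt D ^ 2 = D := Real.sq_sqrt hD
  have h1 : (1 - w) ≠ 0 := sub_ne_zero.mpr (Ne.symm hw)
  field_simp
  rw [hDdef] at hs
  nlinarith [hs]

/-- **(A.20) as printed is not the pole — example 1** (`w = 0 = τ′`, `β = 1/2`, where the printed and the true radicand coincide, `= 9/16`):
the printed location is `−1/2`, `den_A11` does not vanish there (`= −5/4`), and the true root is `1/2`.
[cite: MagnenRivasseauSeneor1993, App. 1 (A.20) p.381] -/
theorem A20_printed_ne_root_example :
    pole_A20_printed (1 / 2) 0 0 = -(1 / 2) ∧ den_A11 (1 / 2) 0 0 (-(1 / 2)) = -(5 / 4) ∧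
      pole_A20_corrected (1 / 2) 0 0 = 1 / 2 ∧ den_A11 (1 / 2) 0 0 (1 / 2) = 0 := by
  have hs : Real.sqrt ((1 - 2 * (1 / 2 : ℝ) * 0 + (1 / 2) ^ 2 + 1 / 2 * 0) ^ 2 - 4 * (1 / 2) ^ 2 * (1 + 0 ^ 2)) = 3 / 4 := by
    rw [show (1 - 2 * (1 / 2 : ℝ) * 0 + (1 / 2) ^ 2 + 1 / 2 * 0) ^ 2 - 4 * (1 / 2) ^ 2 * (1 + 0 ^ 2) = (3 / 4) ^ 2 by norm_num]
    exact Real.sqrt_sq (by norm_num)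
  have hs' : Real.sqrt ((1 - 2 * (1 / 2 : ℝ) * 0 + (1 / 2) ^ 2 + 1 / 2 * 0) ^ 2 - 4 * (1 / 2) ^ 2 * (1 - 0) ^ 2) = 3 / 4 := by
    rw [show (1 - 2 * (1 / 2 : ℝ) * 0 + (1 / 2) ^ 2 + 1 / 2 * 0) ^ 2 - 4 * (1 / 2) ^ 2 * (1 - 0) ^ 2 = (3 / 4) ^ 2 by norm_num]
    exact Real.sqrt_sq (by norm_num)
  refine ⟨?_, ?_, ?_, ?_⟩
  · unfold pole_A20_printed; rw [hs]; norm_num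
  · unfold den_A11; norm_num
  · unfold pole_A20_corrected; rw [hs']; norm_num
  · unfold den_A11; norm_num

/-- **(A.20) as printed is not the pole — example 2** (`β = 1/2`, `w = 5/8`, `τ′ = 0`): the printed radicand `(…)² − 4β²(1 + w²)` equals
`−1 < 0` (no real square root), although `den_A11` has the real root `1/3` inside the unit disk (`den_A11_example_root`); the corrected
discriminant is `1/4`. [cite: MagnenRivasseauSeneor1993, App. 1 (A.20) p.381] -/
theorem A20_printed_radicand_neg_example :
    (1 - 2 * (1 / 2 : ℝ) * (5 / 8) + (1 / 2) ^ 2 + 1 / 2 * 0) ^ 2 - 4 * (1 / 2) ^ 2 * (1 + (5 / 8) ^ 2) = -1 ∧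
      (1 - 2 * (1 / 2 : ℝ) * (5 / 8) + (1 / 2) ^ 2 + 1 / 2 * 0) ^ 2 - 4 * (1 / 2) ^ 2 * (1 - 5 / 8) ^ 2 = 1 / 4 := by
  constructor <;> norm_num

/-- … and at that point `z = 1/3` is a root of `den_A11` (the true pole, `|z| < 1`). [cite: MagnenRivasseauSeneor1993, App. 1 (A.20) p.381] -/
theorem den_A11_example_root : den_A11 (1 / 2) (5 / 8) 0 (1 / 3) = 0 := by
  unfold den_A11; norm_num

/-! ## §4 (v1.1, docfix [REF-G9] F-A25) The radicand of (A.25) AS PRINTED, exhibited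

(A.25) prints its last radicand as «(1 − β)²[(1 + β)² − 4βw] + βτ′(1 − 4βw + 2β² + βτ′)» — with «1» where (A.21)–(A.24) print «2».
The three statements below record exactly how the printed expression relates to the (A.21)–(A.24) radicand used by `kAB_A25`: it
falls short of it by `βτ′`, so the two coincide at `τ′ = 0` (the `t = 0` case, where every check of the warm-up is blind to the slip)
and differ whenever `βτ′ ≠ 0`. Nothing else is claimed. -/

/-- The radicand of (A.25) exactly AS PRINTED [sic]: `(1 − β)²[(1 + β)² − 4βw] + βτ′(1 − 4βw + 2β² + βτ′)`. A record of the print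
only — NOT used by `kAB_A25` (which takes `radicand_A21`, the radicand (A.21)–(A.24) print and the assembly requires).
[cite: MagnenRivasseauSeneor1993, App. 1 (A.25) p.382] -/
def radicand_A25_printed (β w τ' : ℝ) : ℝ :=
  (1 - β) ^ 2 * ((1 + β) ^ 2 - 4 * β * w) + β * τ' * (1 - 4 * β * w + 2 * β ^ 2 + β * τ')

/-- The printed (A.25) radicand is the (A.21)–(A.24) radicand minus `βτ′`. [cite: MagnenRivasseauSeneor1993, App. 1 (A.21), (A.25) pp.381–382] -/
theorem radicand_A25_printed_eq (β w τ' : ℝ) : radicand_A25_printed β w τ' = radicand_A21 β w τ' - β * τ' := by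
  unfold radicand_A25_printed radicand_A21
  ring

/-- … hence the two coincide at `τ′ = 0`. [cite: MagnenRivasseauSeneor1993, App. 1 (A.25) p.382] -/
theorem radicand_A25_printed_eq_of_tau_zero (β w : ℝ) : radicand_A25_printed β w 0 = radicand_A21 β w 0 := by
  rw [radicand_A25_printed_eq]
  ring

/-- … and differ whenever `βτ′ ≠ 0` (e.g. at every point with `τ > 0`, `β > 0` of the paper's range).
[cite: MagnenRivasseauSeneor1993, App. 1 (A.25) p.382] -/
theorem radicand_A25_printed_ne (β w τ' : ℝ) (h : β * τ' ≠ 0) : radicand_A25_printed β w τ' ≠ radicand_A21 β w τ' := by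
  rw [radicand_A25_printed_eq]
  intro h'
  exact h (by linarith)

end AppendixOne

end Literature.MathematicalPhysics.QuantumFieldTheory.MagnenRivasseauSeneor1993
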